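import Summits.ValiantsHypothesis.ValiantsHypothesis.Theses.ValuativeGCT
import Summits.ValiantsHypothesis.ValiantsHypothesis.Theorems.ValuativeGCTNoValuativeFlipUnconditional
import Summits.ValiantsHypothesis.ValiantsHypothesis.Theorems.ValuativeGCTNoValuativeFlipOutsideKL
import Summits.ValiantsHypothesis.ValiantsHypothesis.Theorems.ValuativeGCTValuativeFlipAboveBottom
import Summits.ValiantsHypothesis.ValiantsHypothesis.Theorems.ValuativeGCTValuativeFlipBinaryFormsDeterminantal
import Summits.ValiantsHypothesis.ValiantsHypothesis.Theorems.DetqpThesis.Negative.Variants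

/-!
# Disproof of `HeadFlip` (crux stmt-ValiantsHypothesis-15535, route ValuativeGCT) — findings

Standing adversary file (refuter, cdisprove mode, opening cycle).  Prose lives in docstrings; every
`theorem` is sorry-free except in the final `NearMisses` section.  `HeadFlip` is the LINEAR HEAD of
the parent crux `ValuativeFlip` (stmt-12624): `∃ a b, b < a ∧ ∃ n₀, ∀ n ≥ n₀, ∀ m, n ≤ m → b·m ≤ a·n →
FlipBody n m`, with `FlipBody` LITERALLY the parent's body (checked textually: the `∃ (U …) …` tails of
`ValuativeFlip`, `HeadFlip`, `TailFlip` in the route file coincide byte for byte).  Hence every finding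
of the parent's standing file `Cruxes/ValuativeFlip/Disproof.lean` (F1–F7: conventions audited and
coherent; rank bound is the only clause separating the body from triviality; no flip at `m = 1`, at
one-row shapes, on the null cone the cut is invisible; CutBites holds at `m = 3`) applies verbatim to
the body here and is not repeated; this file adds what is specific to the HEAD WINDOW.

VERDICT (cycle 1): `HeadFlip` SURVIVES cheap refutation; it is not misstated.  Findings:

* **H1 What a kill must look like** (`§ Window`, `not_headFlip_iff`).  `¬ HeadFlip` ⇔ for EVERY
  `k ≥ 1` and infinitely many `n` there is a padded position `n < m ≤ n + n/k` at which NO centre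
  `(U, r)` and NO `(δ, λ)` flips — a "no valuative multiplicity obstruction at some (1+ε)-linear
  padding, for every ε" theorem.  The bottom `m = n` is never available to the refuter
  (`flipBody_self`: the landed Hilbert-function count `valuativeFlip_cruxBody_bottom`, n ≥ 3), and by
  `ValuativeBound` (landed) a no-flip position is in particular a position with no MULTIPLICITY
  obstruction `K_m(λ*) < mult_pp(λ*)` at all.  Nothing in print or in the tree bounds the padded
  permanent's multiplicities from above at linear padding (the landed no-go ranges are `m ≥ 2ⁿ - 1`,
  `m ≥ 1 + n(n+1)^ℓ(λ)`, and off Kadish–Landsberg shapes), so no refutation is within reach; the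
  numerics of the declared lever (four-row count, kit j018409: per side `min(C(n+3,3), 4n²-2n+2)+3`
  vs det side `2m²+2`) point the other way for every slope `< √2`.
* **H2 Normal forms** (`§ Window`).  The slope denominator is load-bearing: `b = 0` would give flips
  at ALL `m ≥ n`, contradicting Grenet (`HeadWitness.slope_pos`, `not_headFlipSlopeZero`); slopes are
  downward closed (`HeadWitness.anti_slope`), so `HeadFlip ⇔ ∃ k ≥ 1, eventually flips on
  n ≤ m ≤ n + n/k` (`headFlip_iff_harmonic`); the threshold is `n₀ ≥ 3` in every witness
  (`HeadWitness.three_le`: `(n, m) = (2, 2)` never flips since `per₂ = det [[x, -y], [z, w]]`,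
  `not_flipBody_two_two`; `n ≤ 1` never flips at any `m`, `not_flipBody_zero_left/one_left`); and the
  head is its padded part (`headFlip_iff_aboveBottom`).
* **H3 Load-bearing hypotheses** (`§ LoadBearing`).  Dropping the eventuality `∃ n₀`
  (`not_headFlipAllN`, witness `n = m = 1`), the window's lower end `n ≤ m` (`not_headFlipWithoutLower`,
  witness `m = 1`: `X₀₀^(1-n)·per(block) = x = det₁` for every `n`, `paddedPerFormLex_at_one`, `not_flipBody_one`), or its upper
  end `b·m ≤ a·n` (`not_headFlipWithoutUpper`, witness `m = 2ⁿ`) makes the statement FALSE; dropping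
  the rank bound `∀ u ∈ U, rank u ≤ r` makes the body trivially TRUE (parent F4,
  `valuativeFlipWithoutRankBound_holds`: `U = ⊤, r = 0` kills `T`).  So a proof must use: large `n`,
  `m ≥ n`… and in fact `m ≥ 3`, the linear ceiling, and the singularity of `U` (or take `U = ⊥`).
* **H4 Shape of a witness** (`§ WitnessShape`).  At any `n ≤ m` a flipping `(U, r, δ, λ)` has
  `ℓ(λ) ≥ 3` (`three_le_card_parts_of_flip`: on two letters `Det_m` majorises every orbit closure —
  binary forms are products of linear forms — landed `orbitMultiplicity_le_det_of_card_le_two`, then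
  `ValuativeBound`), hence `δ ≥ 1`; it is a Kadish–Landsberg shape `δ(m-n) ≤ λ₁`, `ℓ(λ) ≤ n² + 1`
  (`flip_witness_kadishLandsberg`, landed KL/BIP Thm 4.9); and `m + 1 < 2ⁿ` (`flip_witness_below_grenet`).
  Informally (not formalised, `NearMisses`): `ℓ(λ) ≥ 4`, because every ternary form of degree `m` is
  a limit of determinantal ones (Dixon 1902 / Beauville 2000: smooth plane curves carry non-effective
  theta characteristics / degree-`g-1` line bundles without sections), so `Det_m` majorises every
  orbit closure on THREE letters as well; the declared lever (four rows) is therefore the minimal one.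
* **H5 The declared lever's own limit** (`§ FourRowCount`, arithmetic only).  The four-row DIMENSION
  count flips iff `4n² - 2n + 5 > 2m² + 2`, i.e. never once `m² ≥ 2n²` (`fourRowCount_reverses`); with
  the exact small values it first bites at `m = n + 1` for `n = 8`, and at the skeleton's slope-`6/5`
  position `m = ⌊6n/5⌋` for `n = 8, 9` and every `n ≥ 11` (`fourRowCount_table`, `decide`; the
  skeleton's cruder need `2m² + m + 2` also holds from `n = 11` on).  This limits the LINE, not the crux:
  `HeadFlip` quantifies `∃` over the slope, and `k`-row counts for `k ≥ 5` are weaker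
  (`√(k/(k-2)) < √2`), `k ≤ 3` never flips (H4).  A refuter gains nothing here: failure of a count is
  not a no-flip theorem.

Conventions: as audited in the parent file (column `linSubst`, `G ↦ G(A·M)` for the stabiliser,
`G ↦ G(g⁻¹·A)` for the Borel, `L_U = {A | rows ∈ U}`, weight `λ*` of size `-mδ`).
-/

noncomputable section

set_option linter.dupNamespace false

namespace Summit.ValiantsHypothesis.ValiantsHypothesis.Cruxes.HeadFlip.Disproof

open Literature.NumberTheory.DiophantineGeometry Literature.Computability.AlgebraicComplexity
open Summit.ValiantsHypothesis.ValiantsHypothesis.Theses.ValuativeGCT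
open Summit.ValiantsHypothesis.ValiantsHypothesis.Theorems
open MvPolynomial

/-! ## Names for the pieces of the crux (verbatim the parent's `Cruxes/ValuativeFlip/Disproof.lean`) -/

/-- The weight `λ* = (0,…,0,-λ_ℓ,…,-λ₁)` of `λ ⊢ mδ`, transported to `MatIdx m` (the `let χ`). -/
abbrev flipWeight (m δ : ℕ) (lam : Nat.Partition (m * δ)) : Weight (MatIdx m) :=
  (Weight.dualOfPartition (m * m) lam).toMatIdx

/-- The VALUATIVE TRUNCATION `T_U(χ)` of the crux (its `let T`, weight abstracted). -/
def truncT (m : ℕ) (U : Submodule ℂ (MatIdx m → ℂ)) (r δ : ℕ) (χ : Weight (MatIdx m)) :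
    Submodule ℂ (MvPolynomial (MatIdx m × MatIdx m) ℂ) :=
  MvPolynomial.homogeneousSubmodule (MatIdx m × MatIdx m) ℂ (m * δ) ⊓
    ((MvPolynomial.vanishingIdeal ℂ
      {p : MatIdx m × MatIdx m → ℂ | ∀ j : MatIdx m, (fun i => p (j, i)) ∈ U}) ^ (δ * (m - r))).restrictScalars ℂ ⊓
    (⨅ (M : Matrix (MatIdx m) (MatIdx m) ℂ) (_ : linSubst (MatIdx m) ℂ M (detFormLex ℂ m) = detFormLex ℂ m),
      LinearMap.ker ((MvPolynomial.aeval (R := ℂ) fun p : MatIdx m × MatIdx m =>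
        ∑ l : MatIdx m, M l p.2 • MvPolynomial.X (p.1, l)).toLinearMap -
        LinearMap.id (R := ℂ) (M := MvPolynomial (MatIdx m × MatIdx m) ℂ))) ⊓
    (⨅ (g : Matrix.GeneralLinearGroup (MatIdx m) ℂ) (_ : IsUpperTriangular g),
      LinearMap.ker ((MvPolynomial.aeval (R := ℂ) fun p : MatIdx m × MatIdx m =>
        ∑ l : MatIdx m, ((g⁻¹ : Matrix.GeneralLinearGroup (MatIdx m) ℂ) :
          Matrix (MatIdx m) (MatIdx m) ℂ) p.1 l • MvPolynomial.X (l, p.2)).toLinearMap -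
        weightChar χ g • LinearMap.id (R := ℂ) (M := MvPolynomial (MatIdx m × MatIdx m) ℂ)))

/-- The rank bound of the crux: every matrix of `U` has rank `≤ r`. -/
def RankLE (m : ℕ) (U : Submodule ℂ (MatIdx m → ℂ)) (r : ℕ) : Prop :=
  ∀ u ∈ U, (Matrix.of fun a b : Fin m => u (toLex (a, b))).rank ≤ r

/-- The body of the crux at `(n, m)` (identical for `ValuativeFlip`, `HeadFlip`, `TailFlip`). -/
def FlipBody (n m : ℕ) [NeZero m] : Prop :=
  ∃ (U : Submodule ℂ (MatIdx m → ℂ)) (r δ : ℕ) (lam : Nat.Partition (m * δ)),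
    RankLE m U r ∧ lam.parts.card ≤ m * m ∧
      Module.finrank ℂ ↥(truncT m U r δ (flipWeight m δ lam)) <
        orbitMultiplicity ℂ (paddedPerFormLex ℂ n m) m (flipWeight m δ lam)

/-- A HEAD WITNESS at slope `a/b` with threshold `n₀`: flips at every `n ≤ m ≤ (a/b)·n`, `n ≥ n₀`. -/
def HeadWitness (a b n₀ : ℕ) : Prop :=
  ∀ n ≥ n₀, ∀ (m : ℕ) [NeZero m], n ≤ m → b * m ≤ a * n → FlipBody n m

/-- The crux, unfolded into the named pieces (definitional). -/
theorem headFlip_iff : HeadFlip ↔ ∃ a b : ℕ, b < a ∧ ∃ n₀ : ℕ, HeadWitness a b n₀ :=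
  Iff.rfl

/-- The parent crux, unfolded (definitional). -/
theorem valuativeFlip_iff :
    ValuativeFlip ↔ ∀ c : ℕ, ∃ n₀ : ℕ, ∀ n ≥ n₀, ∀ (m : ℕ) [NeZero m],
      n ≤ m → m ≤ 2 ^ ((Nat.log 2 n + c) ^ c) → FlipBody n m :=
  Iff.rfl

/-- The sibling crux, unfolded (definitional). -/
theorem tailFlip_iff :
    TailFlip ↔ ∀ a b : ℕ, b < a → ∀ c : ℕ, ∃ n₀ : ℕ, ∀ n ≥ n₀, ∀ (m : ℕ) [NeZero m],
      a * n < b * m → m ≤ 2 ^ ((Nat.log 2 n + c) ^ c) → FlipBody n m :=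
  Iff.rfl

/-! ## No-flip positions available in the tree, and the free bottom -/

/-- **No flip beyond Grenet** (landed `NoValuativeFlip.noValuativeFlip_body_of_two_pow_le'`:
Grenet's representation, Mulmuley–Sohoni Prop. 4.4, the multiplicity principle, `ValuativeBound`). -/
theorem not_flipBody_of_two_pow_le {n : ℕ} (m : ℕ) [NeZero m] (hm : 2 ^ n ≤ m + 1) :
    ¬ FlipBody n m := by
  rintro ⟨U, r, δ, lam, hU, hcard, hlt⟩
  exact (not_lt.mpr (NoValuativeFlip.noValuativeFlip_body_of_two_pow_le' m hm U r hU δ lam hcard)) hlt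

/-- `n = 0` never flips (at any `m`): `2⁰ ≤ m + 1`. -/
theorem not_flipBody_zero_left (m : ℕ) [NeZero m] : ¬ FlipBody 0 m :=
  not_flipBody_of_two_pow_le m (by simp)

/-- `n = 1` never flips (at any `m ≥ 1`): `2¹ ≤ m + 1`. -/
theorem not_flipBody_one_left (m : ℕ) [NeZero m] : ¬ FlipBody 1 m :=
  not_flipBody_of_two_pow_le m (by have := NeZero.pos m; omega)

/-- **At `m = 1` the padded permanent IS `det₁`**, for every `n`: `X₀₀^(1-n) · per(block)` with the
block the single entry (`n ≥ 1`, exponent `0`) or empty (`n = 0`, exponent `1`); both sides are the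
letter `x`.  (Junk range of `paddedPerPoly`, documented in `OrbitClosure.lean`.) -/
theorem paddedPerFormLex_at_one (n : ℕ) : paddedPerFormLex ℂ n 1 = detFormLex ℂ 1 := by
  unfold paddedPerFormLex detFormLex paddedPerPoly detPoly perPoly
  congr 1
  rw [Matrix.det_fin_one, Matrix.mvPolynomialX_apply]
  rcases Nat.eq_zero_or_pos n with rfl | hn
  · haveI : IsEmpty (BlockIdx 0 1) := ⟨fun i => by have h1 := i.2; have h2 := i.1.2; omega⟩
    rw [Matrix.permanent_isEmpty, map_one, mul_one, Nat.sub_zero, pow_one]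
  · haveI : Subsingleton (BlockIdx n 1) := ⟨fun a b => Subtype.ext (Subsingleton.elim _ _)⟩
    let i₀ : BlockIdx n 1 := ⟨0, by simp only [Fin.val_zero]; omega⟩
    have h1 : (X ((0 : Fin 1), (0 : Fin 1)) : MvPolynomial (Fin 1 × Fin 1) ℂ) ^ (1 - n) = 1 := by
      rw [Nat.sub_eq_zero_of_le hn, pow_zero]
    rw [Matrix.permanent_eq_elem_of_subsingleton _ i₀, Matrix.mvPolynomialX_apply, rename_X, h1, one_mul]

/-- **No witness at `m = 1`, for any `n`** (`paddedPerFormLex_at_one` and `K₁ ≤ dim T`,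
`ValuativeBound_proof`; the parent file proves the same through `dim T = 1`, multiplicities `≤ 1`). -/
theorem not_flipBody_one (n : ℕ) : ¬ FlipBody n 1 := by
  rintro ⟨U, r, δ, lam, hU, hcard, hlt⟩
  rw [paddedPerFormLex_at_one] at hlt
  exact (not_lt.mpr (ValuativeBound.ValuativeBound_proof 1 U r hU δ lam hcard)) hlt

/-- **No witness at `(n, m) = (2, 2)`**: `per₂ ∈ Δ(det₂)` (Mulmuley–Sohoni Prop. 4.4 on
the landed `DetqpThesis.Negative.hasDetRepr_perPoly_two`, transported to the lexicographic letters), the multiplicity principle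
and `ValuativeBound`. -/
theorem not_flipBody_two_two : ¬ FlipBody 2 2 := by
  have hmem : paddedPerFormLex ℂ 2 2 ∈ orbitClosure (detFormLex ℂ 2) :=
    (hasBorderDetRepr_iff_rename_holds (k := ℂ) 2 2).mp
      (paddedPerPoly_mem_orbitClosure_detPoly_of_hasDetRepr_holds
        Summit.ValiantsHypothesis.Theorems.DetqpThesis.Negative.hasDetRepr_perPoly_two le_rfl)
  have hle : ∀ χ : Weight (MatIdx 2), orbitMultiplicity ℂ (paddedPerFormLex ℂ 2 2) 2 χ ≤
      orbitMultiplicity ℂ (detFormLex ℂ 2) 2 χ :=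
    orbitMultiplicity_le_of_mem_orbitClosure_holds (detFormLex ℂ 2) (paddedPerFormLex ℂ 2 2)
      two_ne_zero (detFormLex_isHomogeneous ℂ 2) (paddedPerFormLex_isHomogeneous ℂ le_rfl) hmem
  rintro ⟨U, r, δ, lam, hU, hcard, hlt⟩
  exact (not_lt.mpr ((hle _).trans (ValuativeBound.ValuativeBound_proof 2 U r hU δ lam hcard))) hlt

/-- **The bottom of every window flips** (landed `ValuativeFlip.valuativeFlip_cruxBody_bottom`,
`n ≥ 3`, no-cut centre `U = ⊥`, `r = 0`, a Hilbert-function count).  So the refuter's `m` is padded. -/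
theorem flipBody_self (n : ℕ) [NeZero n] (hn : 3 ≤ n) : FlipBody n n :=
  ValuativeFlip.valuativeFlip_cruxBody_bottom n hn

/-! ## Window and slope bookkeeping -/

namespace HeadWitness

variable {a b n₀ : ℕ}

/-- Raising the threshold keeps a witness. -/
theorem mono_threshold (h : HeadWitness a b n₀) {n₁ : ℕ} (hn : n₀ ≤ n₁) : HeadWitness a b n₁ :=
  fun n hn' m _ hnm hbm => h n (hn.trans hn') m hnm hbm

/-- **The slope denominator is load-bearing**: `b = 0` would mean flips at EVERY `m ≥ n`
(`0·m ≤ a·n`), contradicting the no-flip range beyond Grenet (`m = 2ⁿ`). -/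
theorem slope_pos (h : HeadWitness a b n₀) : 0 < b := by
  by_contra hb
  obtain rfl : b = 0 := by omega
  set n : ℕ := max n₀ 1 with hn
  haveI : NeZero (2 ^ n) := ⟨(Nat.two_pow_pos n).ne'⟩
  exact not_flipBody_of_two_pow_le (n := n) (2 ^ n) (Nat.le_succ _)
    (h n (le_max_left _ _) (2 ^ n) Nat.lt_two_pow_self.le (by simp))

/-- **Every threshold is at least `3`**: `(n, m) = (2, 2)` is admissible for every slope `≥ 1`
and never flips (`not_flipBody_two_two`). -/
theorem three_le (h : HeadWitness a b n₀) (hba : b ≤ a) : 3 ≤ n₀ := by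
  by_contra hn
  exact not_flipBody_two_two (h 2 (by omega) 2 le_rfl (by omega))

/-- **Slopes are downward closed**: a witness at slope `a/b` is a witness at every slope
`a'/b' ≤ a/b` (`b' > 0`). -/
theorem anti_slope (h : HeadWitness a b n₀) {a' b' : ℕ} (hb' : 0 < b') (hle : a' * b ≤ a * b') :
    HeadWitness a' b' n₀ := by
  intro n hn m _ hnm hbm
  refine h n hn m hnm ?_
  have h1 : b' * (b * m) ≤ b' * (a * n) := by
    calc b' * (b * m) = b * (b' * m) := by ring
      _ ≤ b * (a' * n) := Nat.mul_le_mul_left _ hbm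
      _ = (a' * b) * n := by ring
      _ ≤ (a * b') * n := Nat.mul_le_mul_right _ hle
      _ = b' * (a * n) := by ring
  exact Nat.le_of_mul_le_mul_left h1 hb'

/-- A witness at slope `a/b > 1` is a witness at the harmonic slope `(b+1)/b`. -/
theorem harmonic (h : HeadWitness a b n₀) (hba : b < a) : HeadWitness (b + 1) b n₀ :=
  h.anti_slope h.slope_pos (Nat.mul_le_mul_right _ hba)

/-- Restriction of a witness to its PADDED positions `n < m` loses nothing that matters. -/
theorem above_bottom (h : HeadWitness a b n₀) :
    ∀ n ≥ n₀, ∀ (m : ℕ) [NeZero m], n < m → b * m ≤ a * n → FlipBody n m :=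
  fun n hn m _ hnm hbm => h n hn m hnm.le hbm

end HeadWitness

/-- **Normal form 1 (harmonic slopes).**  `HeadFlip ⇔ ∃ k ≥ 1, eventually flips on
`n ≤ m ≤ n + n/k`. -/
theorem headFlip_iff_harmonic : HeadFlip ↔ ∃ k : ℕ, 0 < k ∧ ∃ n₀ : ℕ, HeadWitness (k + 1) k n₀ := by
  rw [headFlip_iff]
  constructor
  · rintro ⟨a, b, hba, n₀, h⟩
    exact ⟨b, h.slope_pos, n₀, h.harmonic hba⟩
  · rintro ⟨k, -, n₀, h⟩
    exact ⟨k + 1, k, Nat.lt_succ_self k, n₀, h⟩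

/-- **Normal form 2 (the head is its padded part).**  `HeadFlip` is equivalent to the same statement
with `n ≤ m` replaced by `n < m`: the bottom `m = n` is served by `flipBody_self` (`n₀ := max n₀ 3`). -/
theorem headFlip_iff_aboveBottom :
    HeadFlip ↔ ∃ a b : ℕ, b < a ∧ ∃ n₀ : ℕ, ∀ n ≥ n₀, ∀ (m : ℕ) [NeZero m],
      n < m → b * m ≤ a * n → FlipBody n m := by
  rw [headFlip_iff]
  constructor
  · rintro ⟨a, b, hba, n₀, h⟩
    exact ⟨a, b, hba, n₀, h.above_bottom⟩
  · rintro ⟨a, b, hba, n₀, h⟩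
    refine ⟨a, b, hba, max n₀ 3, fun n hn m _ hnm hbm => ?_⟩
    rcases hnm.eq_or_lt with rfl | hlt
    · exact flipBody_self n (le_of_max_le_right hn)
    · exact h n (le_of_max_le_left hn) m hlt hbm

/-- **Normal form 3 (thresholds and slopes).**  Every witness has `0 < b` and `3 ≤ n₀`. -/
theorem headFlip_iff_normal :
    HeadFlip ↔ ∃ a b : ℕ, b < a ∧ 0 < b ∧ ∃ n₀ : ℕ, 3 ≤ n₀ ∧ HeadWitness a b n₀ := by
  rw [headFlip_iff]
  constructor
  · rintro ⟨a, b, hba, n₀, h⟩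
    exact ⟨a, b, hba, h.slope_pos, n₀, h.three_le hba.le, h⟩
  · rintro ⟨a, b, hba, -, n₀, -, h⟩
    exact ⟨a, b, hba, n₀, h⟩

/-- **What a refutation must produce** (H1).  `¬ HeadFlip` iff for every `k ≥ 1` and every
threshold there are `n` beyond it and a PADDED position `n < m`, `k·m ≤ (k+1)·n`, with no flip at
all — no centre, no degree, no shape. -/
theorem not_headFlip_iff :
    ¬ HeadFlip ↔ ∀ k : ℕ, 0 < k → ∀ n₀ : ℕ, ∃ n ≥ n₀, ∃ (m : ℕ) (_ : NeZero m),
      n < m ∧ k * m ≤ (k + 1) * n ∧ ¬ FlipBody n m := by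
  constructor
  · intro h k hk n₀
    by_contra hcon
    push Not at hcon
    apply h
    rw [headFlip_iff_aboveBottom]
    exact ⟨k + 1, k, Nat.lt_succ_self k, n₀, fun n hn m inst hnm hkm => hcon n hn m inst hnm hkm⟩
  · intro h hH
    obtain ⟨k, hk, n₀, hw⟩ := headFlip_iff_harmonic.mp hH
    obtain ⟨n, hn, m, inst, hnm, hkm, hno⟩ := h k hk n₀
    exact hno (hw n hn m hnm.le hkm)

/-! ## Load-bearing hypotheses (mutation: each dropped clause flips the truth value) -/

/-- The crux with the eventuality `∃ n₀, ∀ n ≥ n₀` replaced by `∀ n`. -/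
def HeadFlipAllN : Prop :=
  ∃ a b : ℕ, b < a ∧ ∀ n : ℕ, ∀ (m : ℕ) [NeZero m], n ≤ m → b * m ≤ a * n → FlipBody n m

/-- **Any proof must use the eventuality**: `n = m = 1` is admissible for every slope and never
flips. -/
theorem not_headFlipAllN : ¬ HeadFlipAllN := by
  rintro ⟨a, b, hba, h⟩
  exact not_flipBody_one 1 (h 1 1 le_rfl (by omega))

/-- The crux with the window's LOWER end `n ≤ m` deleted. -/
def HeadFlipWithoutLower : Prop :=
  ∃ a b : ℕ, b < a ∧ ∃ n₀ : ℕ, ∀ n ≥ n₀, ∀ (m : ℕ) [NeZero m], b * m ≤ a * n → FlipBody n m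

/-- **Any proof must use `n ≤ m`**: without it `m = 1` is admissible for all large `n`
(`b·1 ≤ a·n`) and never flips (`not_flipBody_one`; at `m = 1` the padded permanent is the junk
`x = det₁`). -/
theorem not_headFlipWithoutLower : ¬ HeadFlipWithoutLower := by
  rintro ⟨a, b, hba, n₀, h⟩
  refine not_flipBody_one (max n₀ 1) (h _ (le_max_left _ _) 1 ?_)
  have : 1 ≤ max n₀ 1 := le_max_right _ _
  nlinarith

/-- The crux with the window's UPPER end `b·m ≤ a·n` deleted (equivalently: slope `b = 0`). -/
def HeadFlipWithoutUpper : Prop :=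
  ∃ n₀ : ℕ, ∀ n ≥ n₀, ∀ (m : ℕ) [NeZero m], n ≤ m → FlipBody n m

/-- **Any proof must use the linear ceiling**: without it `m = 2ⁿ` is admissible and never flips
(Grenet). -/
theorem not_headFlipWithoutUpper : ¬ HeadFlipWithoutUpper := by
  rintro ⟨n₀, h⟩
  have hw : HeadWitness 1 0 n₀ := fun n hn m _ hnm _ => h n hn m hnm
  exact (lt_irrefl 0) hw.slope_pos

/-- The `b = 0` instance of the crux (all `m ≥ n`). -/
def HeadFlipSlopeZero : Prop :=
  ∃ a : ℕ, 0 < a ∧ ∃ n₀ : ℕ, HeadWitness a 0 n₀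

/-- **The slope-zero instance is false** (`HeadWitness.slope_pos`). -/
theorem not_headFlipSlopeZero : ¬ HeadFlipSlopeZero := by
  rintro ⟨a, -, n₀, h⟩
  exact (lt_irrefl 0) h.slope_pos

/-! ## Shape of a witness (natural strengthenings refuted) -/

section WitnessShape

variable {n m : ℕ} [NeZero m]

/-- **Witnesses have at least three rows.**  For `n ≤ m`, a flipping `(U, r, δ, λ)` has
`3 ≤ ℓ(λ)`: the dual weight of a partition with `≤ 2` parts is supported on the last two
lexicographic letters, where `Det_m` majorises every orbit closure (binary forms are products of
linear forms: landed `ValuativeFlip.orbitMultiplicity_le_det_of_card_le_two`), and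
`K_m(λ*) ≤ dim T_U(λ)` (`ValuativeBound_proof`).  In particular `δ ≥ 1` and the natural
strengthening "a flip on a two-row (Kronecker-computable) shape" is FALSE at every position. -/
theorem three_le_card_parts_of_flip (hnm : n ≤ m) (U : Submodule ℂ (MatIdx m → ℂ)) (r δ : ℕ)
    (lam : Nat.Partition (m * δ)) (hU : RankLE m U r) (hcard : lam.parts.card ≤ m * m)
    (hlt : Module.finrank ℂ ↥(truncT m U r δ (flipWeight m δ lam)) <
      orbitMultiplicity ℂ (paddedPerFormLex ℂ n m) m (flipWeight m δ lam)) :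
    3 ≤ lam.parts.card := by
  classical
  by_contra h3
  set ρ := lam.parts.card with hρ
  have hρ2 : ρ ≤ 2 := by omega
  have hmpos : 0 < m := NeZero.pos m
  have hmm : 1 ≤ m * m := Nat.one_le_iff_ne_zero.mpr (Nat.mul_ne_zero hmpos.ne' hmpos.ne')
  -- the last `ρ` lexicographic positions
  let S : Finset (MatIdx m) := Finset.univ.image fun t : Fin ρ =>
    matIdxEquiv m ⟨m * m - 1 - t, by omega⟩
  have hScard : S.card ≤ 2 := Finset.card_image_le.trans (by simpa using hρ2)
  have hχ : ∀ i, i ∉ S → flipWeight m δ lam i = 0 := by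
    intro i hi
    obtain ⟨i', rfl⟩ : ∃ i' : Fin (m * m), matIdxEquiv m i' = i :=
      ⟨(matIdxEquiv m).symm i, (matIdxEquiv m).apply_symm_apply i⟩
    by_cases hlt' : (i' : ℕ) + ρ < m * m
    · exact NoValuativeFlip.dualOfPartition_toMatIdx_eq_zero_of_lt lam i' hlt'
    · exfalso
      apply hi
      refine Finset.mem_image.mpr ⟨⟨m * m - 1 - i', by omega⟩, Finset.mem_univ _, ?_⟩
      congr 1
      exact Fin.ext (by simp; omega)
  have hle := ValuativeFlip.orbitMultiplicity_le_det_of_card_le_two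
    (paddedPerFormLex_isHomogeneous ℂ hnm) S hScard (flipWeight m δ lam) hχ
  exact (not_lt.mpr (hle.trans (ValuativeBound.ValuativeBound_proof m U r hU δ lam hcard))) hlt

/-- Hence `δ ≥ 1` in every witness (a partition of `0` has no parts). -/
theorem delta_pos_of_flip (hnm : n ≤ m) (U : Submodule ℂ (MatIdx m → ℂ)) (r δ : ℕ)
    (lam : Nat.Partition (m * δ)) (hU : RankLE m U r) (hcard : lam.parts.card ≤ m * m)
    (hlt : Module.finrank ℂ ↥(truncT m U r δ (flipWeight m δ lam)) <
      orbitMultiplicity ℂ (paddedPerFormLex ℂ n m) m (flipWeight m δ lam)) :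
    0 < δ := by
  have h3 := three_le_card_parts_of_flip hnm U r δ lam hU hcard hlt
  by_contra hδ
  obtain rfl : δ = 0 := by omega
  have hsum : lam.parts.sum = 0 := lam.parts_sum.trans (Nat.mul_zero m)
  have : lam.parts = 0 := by
    by_contra hne
    obtain ⟨x, hx⟩ := Multiset.exists_mem_of_ne_zero hne
    have hxpos := lam.parts_pos hx
    have := Multiset.le_sum_of_mem hx
    omega
  rw [this, Multiset.card_zero] at h3
  omega

/-- **Witnesses are Kadish–Landsberg shapes**: `δ(m-n) ≤ λ₁` and `ℓ(λ) ≤ n² + 1` (landed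
`NoValuativeFlip.kadishLandsberg_of_hasHighestWeight_paddedPerOrbitRep`, = KL 2014 / BIP 2019
Thm 4.9, applied to the occurrence `0 < mult_pp(λ*)` forced by the strict inequality). -/
theorem flip_witness_kadishLandsberg (hnm : n ≤ m) (U : Submodule ℂ (MatIdx m → ℂ)) (r δ : ℕ)
    (lam : Nat.Partition (m * δ)) (hcard : lam.parts.card ≤ m * m)
    (hlt : Module.finrank ℂ ↥(truncT m U r δ (flipWeight m δ lam)) <
      orbitMultiplicity ℂ (paddedPerFormLex ℂ n m) m (flipWeight m δ lam)) :
    δ * (m - n) ≤ lam.parts.sup ∧ lam.parts.card ≤ n ^ 2 + 1 := by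
  refine NoValuativeFlip.kadishLandsberg_of_hasHighestWeight_paddedPerOrbitRep hnm lam hcard ?_
  have hpos : 0 < orbitMultiplicity ℂ (paddedPerFormLex ℂ n m) m (flipWeight m δ lam) := by omega
  intro hbot
  change highestWeightSpace (orbitCoordRep (paddedPerFormLex ℂ n m) m) (flipWeight m δ lam) = ⊥ at hbot
  rw [orbitMultiplicity, hwMultiplicity, hbot, finrank_bot] at hpos
  exact lt_irrefl 0 hpos

/-- **Witnesses sit below Grenet**: `m + 1 < 2ⁿ`. -/
theorem flip_witness_below_grenet (h : FlipBody n m) : m + 1 < 2 ^ n := by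
  by_contra hle
  exact not_flipBody_of_two_pow_le m (not_lt.mp hle) h

end WitnessShape

/-! ## The declared lever's own limit (four-row dimension count; arithmetic only, H5)

These are statements about the HEURISTIC behind line `four-row-count` (per side
`dim P_{m,4} = min(C(n+3,3), 4n²-2n+2) + 3`, det side Krull dimension `2m² + 2`), not about the crux. -/

/-- The per-side four-row count of the line card (padded permanental pencils in four variables). -/
def perCount4 (n : ℕ) : ℕ := min (Nat.choose (n + 3) 3) (4 * (n * n) - 2 * n + 2) + 3

/-- The det-side four-row count of the line card (determinantal quaternary `m`-ics, cone). -/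
def detCount4 (m : ℕ) : ℕ := 2 * (m * m) + 2

/-- The skeleton's cruder det-side need (`stub_fourRowPencilRank`: rank `≥ 2m² + m + 2`, slice
exponent `2m² + m` of `stub_fourRowSliceBound`). -/
def skeletonNeed4 (m : ℕ) : ℕ := 2 * (m * m) + m + 2

/-- **The count never flips once `m² ≥ 2n²`** (so the lever is confined to slopes `< √2`). -/
theorem fourRowCount_reverses {n m : ℕ} (hn : 2 ≤ n) (h : 2 * (n * n) ≤ m * m) :
    perCount4 n ≤ detCount4 m := by
  unfold perCount4 detCount4
  have h1 : min (Nat.choose (n + 3) 3) (4 * (n * n) - 2 * n + 2) ≤ 4 * (n * n) - 2 * n + 2 :=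
    min_le_right _ _
  have h2 : n ≤ n * n := Nat.le_mul_self n
  omega

/-- **Where the count first bites** (exact small values).  At `m = n + 1`: not for `3 ≤ n ≤ 7`, first
at `n = 8` (`168 > 164`).  At the skeleton's slope-`6/5` position `m = ⌊6n/5⌋`: not for
`n = 5, 6, 7, 10` (`n = 10`: `289 ≤ 290`), yes for `n = 8, 9` and for every `11 ≤ n ≤ 40`; the
skeleton's cruder need `2m² + m + 2 ≤` per-count holds for every `11 ≤ n ≤ 40` and fails at
`n = 10` — so `stub_fourRowPencilRank`'s threshold is `n₀ ≥ 11` if the numerics are exact. -/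
theorem fourRowCount_table :
    (∀ n ∈ Finset.Icc 3 7, perCount4 n ≤ detCount4 (n + 1)) ∧ detCount4 9 < perCount4 8 ∧
    (∀ n ∈ ({5, 6, 7, 10} : Finset ℕ), perCount4 n ≤ detCount4 (6 * n / 5)) ∧
    (∀ n ∈ ({8, 9} : Finset ℕ), detCount4 (6 * n / 5) < perCount4 n) ∧
    (∀ n ∈ Finset.Icc 11 40, detCount4 (6 * n / 5) < perCount4 n) ∧
    (∀ n ∈ Finset.Icc 11 40, skeletonNeed4 (6 * n / 5) ≤ perCount4 n) ∧
    perCount4 10 < skeletonNeed4 12 := by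
  decide

/-! ## Consequences of a kill (for the route's kill criteria) -/

/-- **Refuting the head refutes the parent**: `ValuativeFlip → HeadFlip` (slope `2/1`, window exponent
`c = 2`: `m ≤ 2n < 2^(log₂ n + 2) ≤ 2^((log₂ n + 2)²)`; this is the content of the provable-now glue item
`ValuativeFlipToHead`, stmt-15804, used here only contrapositively). -/
theorem not_valuativeFlip_of_not_headFlip (h : ¬ HeadFlip) : ¬ ValuativeFlip := by
  intro hV
  apply h
  obtain ⟨n₀, hn₀⟩ := (valuativeFlip_iff.mp hV) 2
  refine headFlip_iff.mpr ⟨2, 1, one_lt_two, n₀, fun n hn m _ hnm hbm => hn₀ n hn m hnm ?_⟩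
  have h1 : n < 2 ^ (Nat.log 2 n + 1) := Nat.lt_pow_succ_log_self one_lt_two n
  have h2 : 2 ^ (Nat.log 2 n + 1 + 1) ≤ 2 ^ ((Nat.log 2 n + 2) ^ 2) :=
    Nat.pow_le_pow_right two_pos (by nlinarith)
  rw [pow_succ] at h2
  omega

/-- **… and is at least as hard as a linear-padding no-go**: a refutation yields, for every `k ≥ 1`,
infinitely many `n` with a padded position `n < m ≤ n + n/k` carrying NO multiplicity obstruction
`K_m(λ*) < mult_pp(λ*)` at any Kadish–Landsberg shape with `ℓ(λ) ≥ 3` (the other shapes never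
obstruct) — by `ValuativeBound` every multiplicity obstruction is a valuative flip at `U = ⊥`.
Stated here in the weakest useful form: no sk-type flip at the no-cut centre. -/
theorem noCut_noFlip_of_not_headFlip (h : ¬ HeadFlip) (k : ℕ) (hk : 0 < k) (n₀ : ℕ) :
    ∃ n ≥ n₀, ∃ (m : ℕ) (_ : NeZero m), n < m ∧ k * m ≤ (k + 1) * n ∧
      ∀ (δ : ℕ) (lam : Nat.Partition (m * δ)), lam.parts.card ≤ m * m →
        orbitMultiplicity ℂ (paddedPerFormLex ℂ n m) m (flipWeight m δ lam) ≤
          Module.finrank ℂ ↥(truncT m ⊥ 0 δ (flipWeight m δ lam)) := by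
  obtain ⟨n, hn, m, inst, hnm, hkm, hno⟩ := (not_headFlip_iff.mp h) k hk n₀
  refine ⟨n, hn, m, inst, hnm, hkm, fun δ lam hcard => ?_⟩
  by_contra hlt
  exact hno ⟨⊥, 0, δ, lam, fun u hu => by
    rw [(Submodule.mem_bot ℂ).mp hu]
    have h0 : (Matrix.of fun a b : Fin m => (0 : MatIdx m → ℂ) (toLex (a, b))) = 0 := by
      ext; simp
    rw [h0, Matrix.rank_zero], hcard, not_le.mp hlt⟩

/-! ## Near-misses (sorried; the only place in this file where `sorry` is allowed) -/

section NearMisses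

/-- **NEAR-MISS (true, unformalised): witnesses have at least FOUR rows.**  On three letters
`Det_m` majorises every orbit closure as well: the closure of `{det M(y) : M ∈ (ℂ³)^{m×m} linear}` is
ALL ternary forms of degree `m`, because a smooth plane curve `C` of degree `m` admits a linear
determinantal representation `C = {det M = 0}` for every line bundle `L` of degree `g - 1` with
`h⁰(L) = 0` (Dixon 1902 for symmetric ones via ineffective theta characteristics; Beauville,
Michigan Math. J. 48 (2000), Prop. 3.1 / Cor. 3.2), and such `L` exist on every smooth curve (the
theta divisor is a proper subvariety of `Pic^{g-1}`).  Then support transfer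
(`NoValuativeFlip.orbitMultiplicity_le_of_weight_support` over a three-letter analogue of
`linSubst_mem_orbitClosure_detFormLex_of_card_le_two`) and `ValuativeBound` give the claim.
OBSTRUCTION: no theory of line bundles on plane curves / determinantal representations in Mathlib;
the density statement "generic ternary `m`-ic is determinantal" is the whole content.  Consequence
for the crux: the four-row lever of line `four-row-count` is the MINIMAL number of rows at which a
flip can exist at all; for the refuter: nothing (a flip on `≥ 4` rows is exactly what is claimed). -/
theorem four_le_card_parts_of_flip {n m : ℕ} [NeZero m] (hnm : n ≤ m)
    (U : Submodule ℂ (MatIdx m → ℂ)) (r δ : ℕ)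
    (lam : Nat.Partition (m * δ)) (hU : RankLE m U r) (hcard : lam.parts.card ≤ m * m)
    (hlt : Module.finrank ℂ ↥(truncT m U r δ (flipWeight m δ lam)) <
      orbitMultiplicity ℂ (paddedPerFormLex ℂ n m) m (flipWeight m δ lam)) :
    4 ≤ lam.parts.card := by
  sorry

end NearMisses

end Summit.ValiantsHypothesis.ValiantsHypothesis.Cruxes.HeadFlip.Disproof

end
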